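import Mathlib
import Literature.NumberTheory.Transcendental.KZProduct
import Literature.NumberTheory.Transcendental.KZSemiCanonicalReductionProofs
import Literature.NumberTheory.Transcendental.KZDominatedFamilyRelations
import Literature.NumberTheory.Transcendental.SemialgebraicMapsProofs
import Summits.KontsevichZagierPeriods.KontsevichZagierPeriods.Theorems.SoloInformedPolyJacobian
import Summits.KontsevichZagierPeriods.KontsevichZagierPeriods.Theorems.SoloInformedKZStokesCells
import Summits.KontsevichZagierPeriods.KontsevichZagierPeriods.Theorems.SoloInformedPiDiscQuarters
import Summits.KontsevichZagierPeriods.KontsevichZagierPeriods.Theorems.SoloInformedDiscCancellation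
import HarnessLib
import HarnessLib.Audit

/-!
# SoloInformed — solids of revolution in the Kontsevich–Zagier calculus, I

For a planar region `A ⊆ {u ≥ 0} × ℝ` (coordinates `(u, z)`, `u` = distance to the axis) the
*solid of revolution* is `Rev A = {x ∈ ℝ³ | (√(x₀² + x₁²), x₂) ∈ A}`. This file sets up, inside
the audited four-move calculus `KZ.relations` (`KZCalculus.lean`):

* `soloInformedRevRep K` = `[Rev K, 1]` (for a representation `K` of dimension `2` with compact
  domain; `Rev` is `ℚ`-semialgebraic by Tarski–Seidenberg, being a coordinate projection);
* rule (1a) + rule (2): `[Rev K, 1]` is the sum of its four open quarters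
  `{ε₀ x₀ > 0, ε₁ x₁ > 0}`, and the sign flips identify the quarters, so that
  `[Rev K, 1] − 4 · [first quarter, 1] ∈ relations`
  (`soloInformed_revRep_sub_four_nsmul_quarter_mem_relations`).

The companion files `SoloInformedRevolutionFlatten` (the flattening `Λ(u, z) = (u², z)` of the
profile), `SoloInformedRevolutionPolar` (the polynomial cylindrical change of variables) and
`SoloInformedPappus` assemble Pappus' theorem `[Rev K, 1] ∼ [D̄ × Λ K, 1]` in the calculus and
deduce volume rung `3` for solids of revolution about a common axis.

Residency `solo-KontsevichZagierPeriods-informed` (PLAN.md, session s16).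
References: M. Kontsevich, D. Zagier, *Periods* (2001), §1.1–§1.2 (the rules);
J. Bochnak, M. Coste, M.-F. Roy, *Real algebraic geometry* (1998), Prop. 2.2.7 (images).
-/

noncomputable section

open MeasureTheory Set Filter
open scoped Topology

namespace Summit.KontsevichZagierPeriods.KontsevichZagierPeriods.Theorems

open Literature.NumberTheory.Transcendental Literature.NumberTheory.Transcendental.KZ
open Literature.ModelTheory.ExponentialFields (IsSemialgebraic isSemialgebraic_setOf_eval_le
  isSemialgebraic_setOf_eval_lt isSemialgebraic_setOf_eval_pos isSemialgebraic_setOf_eval_eq_zero)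

/-! ### The solid of revolution of a planar region -/

/-- The profile map `x ↦ (√(x₀² + x₁²), x₂)` (distance to the axis, height). -/
def soloInformedProfile (x : Fin 3 → ℝ) : Fin 2 → ℝ := ![Real.sqrt (x 0 ^ 2 + x 1 ^ 2), x 2]

/-- First component of the profile map. -/
@[simp] theorem soloInformedProfile_zero (x : Fin 3 → ℝ) :
    soloInformedProfile x 0 = Real.sqrt (x 0 ^ 2 + x 1 ^ 2) := rfl

/-- Second component of the profile map. -/
@[simp] theorem soloInformedProfile_one (x : Fin 3 → ℝ) : soloInformedProfile x 1 = x 2 := rfl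

/-- The profile map is continuous. -/
theorem soloInformed_continuous_profile : Continuous soloInformedProfile := by
  refine continuous_pi fun j => ?_
  fin_cases j
  · simpa using (((continuous_apply 0).pow 2).add ((continuous_apply 1).pow 2)).sqrt
  · simpa using (continuous_apply 2)

/-- The solid of revolution `Rev A = {x | (√(x₀² + x₁²), x₂) ∈ A}` of a planar region `A`. -/
def soloInformedRev (A : Set (Fin 2 → ℝ)) : Set (Fin 3 → ℝ) := soloInformedProfile ⁻¹' A

/-- Membership in the solid of revolution. -/
@[simp] theorem soloInformed_mem_rev {A : Set (Fin 2 → ℝ)} {x : Fin 3 → ℝ} :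
    x ∈ soloInformedRev A ↔ soloInformedProfile x ∈ A := Iff.rfl

/-- **The solid of revolution of a `ℚ`-semialgebraic region is `ℚ`-semialgebraic**: it is the
coordinate projection of `{(x, s) | 0 ≤ s, s² = x₀² + x₁², (s, x₂) ∈ A} ⊆ ℝ⁴` (Tarski–Seidenberg,
`IsSemialgebraicMapOn.isSemialgebraic_image_holds`). [Bochnak–Coste–Roy 1998, Prop. 2.2.7] -/
theorem isSemialgebraic_soloInformedRev {A : Set (Fin 2 → ℝ)} (hA : IsSemialgebraic ℚ A) :
    IsSemialgebraic ℚ (soloInformedRev A) := by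
  have h1 := isSemialgebraic_setOf_eval_le (k := ℚ) (R := ℝ) (0 : MvPolynomial (Fin 4) ℚ)
    (MvPolynomial.X 3)
  have h2 := isSemialgebraic_setOf_eval_eq_zero (k := ℚ) (R := ℝ)
    (MvPolynomial.X 3 ^ 2 - (MvPolynomial.X 0 ^ 2 + MvPolynomial.X 1 ^ 2) : MvPolynomial (Fin 4) ℚ)
  have h3 := hA.preimage_comp (![3, 2] : Fin 2 → Fin 4)
  have hW := h1.inter (h2.inter h3)
  have himg := IsSemialgebraicMapOn.isSemialgebraic_image_holds (isSemialgebraicMapOn_aeval hW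
    (fun j : Fin 3 => (MvPolynomial.X ((![0, 1, 2] : Fin 3 → Fin 4) j) : MvPolynomial (Fin 4) ℚ)))
    Subset.rfl hW
  simp only [map_zero, MvPolynomial.aeval_X, map_sub, map_add, map_pow] at himg
  convert himg using 1
  ext x
  simp only [soloInformed_mem_rev, mem_image, mem_inter_iff, mem_setOf_eq, mem_preimage]
  constructor
  · intro hx
    refine ⟨![x 0, x 1, x 2, Real.sqrt (x 0 ^ 2 + x 1 ^ 2)], ⟨?_, ?_, ?_⟩, ?_⟩
    · simp
    · have h : Real.sqrt (x 0 ^ 2 + x 1 ^ 2) ^ 2 = x 0 ^ 2 + x 1 ^ 2 := Real.sq_sqrt (by positivity)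
      simp [h]
    · have h : ((![x 0, x 1, x 2, Real.sqrt (x 0 ^ 2 + x 1 ^ 2)] : Fin 4 → ℝ) ∘
          (![3, 2] : Fin 2 → Fin 4)) = soloInformedProfile x := by
        ext j; fin_cases j <;> simp [soloInformedProfile]
      rw [h]; exact hx
    · ext j; fin_cases j <;> simp
  · rintro ⟨w, ⟨hw1, hw2, hw3⟩, rfl⟩
    have hw1' : 0 ≤ w 3 := by simpa using hw1
    have hs : Real.sqrt (w 0 ^ 2 + w 1 ^ 2) = w 3 := by
      rw [show w 0 ^ 2 + w 1 ^ 2 = w 3 ^ 2 by linarith, Real.sqrt_sq hw1']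
    have h : soloInformedProfile (fun j => w ((![0, 1, 2] : Fin 3 → Fin 4) j)) =
        w ∘ (![3, 2] : Fin 2 → Fin 4) := by
      ext j; fin_cases j <;> simp [soloInformedProfile, hs]
    rw [h]; exact hw3

/-- Points of the solid are bounded by any sup-norm bound of the region. -/
theorem soloInformedRev_subset_closedBall {A : Set (Fin 2 → ℝ)} {R : ℝ} (hA : ∀ y ∈ A, ‖y‖ ≤ R) :
    soloInformedRev A ⊆ Metric.closedBall 0 R := by
  intro x hx
  have hy := hA _ hx
  have hR : 0 ≤ R := (norm_nonneg _).trans hy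
  have h0 := (norm_le_pi_norm (soloInformedProfile x) 0).trans hy
  have h2 := (norm_le_pi_norm (soloInformedProfile x) 1).trans hy
  rw [soloInformedProfile_zero, Real.norm_eq_abs] at h0
  rw [soloInformedProfile_one, Real.norm_eq_abs] at h2
  have hs : Real.sqrt (x 0 ^ 2 + x 1 ^ 2) ≤ R := (le_abs_self _).trans h0
  have hx0 : |x 0| ≤ R := by
    rw [← Real.sqrt_sq_eq_abs]
    exact (Real.sqrt_le_sqrt (by nlinarith [sq_nonneg (x 1)])).trans hs
  have hx1 : |x 1| ≤ R := by
    rw [← Real.sqrt_sq_eq_abs]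
    exact (Real.sqrt_le_sqrt (by nlinarith [sq_nonneg (x 0)])).trans hs
  rw [mem_closedBall_zero_iff, pi_norm_le_iff_of_nonneg hR]
  intro i
  fin_cases i
  · simpa [Real.norm_eq_abs] using hx0
  · simpa [Real.norm_eq_abs] using hx1
  · simpa [Real.norm_eq_abs] using h2

/-- **The solid of revolution** `[Rev K, 1]` of (the domain of) a planar representation `K` with
compact domain, as an integral representation of dimension `3`. -/
def soloInformedRevRep (K : IntegralRep 2) (hKc : IsCompact K.domain) : IntegralRep 3 where
  domain := soloInformedRev K.domain
  integrand _ := 1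
  isSemialgebraic_domain := isSemialgebraic_soloInformedRev K.isSemialgebraic_domain
  isSemialgebraicFunOn_integrand := by
    simpa using isSemialgebraicFunOn_ratCast
      (isSemialgebraic_soloInformedRev K.isSemialgebraic_domain) 1
  integrableOn := by
    obtain ⟨R, hR⟩ := hKc.isBounded.exists_norm_le
    exact (continuous_const.continuousOn.integrableOn_compact
      (isCompact_closedBall (0 : Fin 3 → ℝ) R)).mono_set (soloInformedRev_subset_closedBall hR)

/-- Domain of the solid of revolution. -/
@[simp] theorem soloInformedRevRep_domain (K : IntegralRep 2) (hKc : IsCompact K.domain) :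
    (soloInformedRevRep K hKc).domain = soloInformedRev K.domain := rfl

/-- Integrand of the solid of revolution. -/
@[simp] theorem soloInformedRevRep_integrand (K : IntegralRep 2) (hKc : IsCompact K.domain) :
    (soloInformedRevRep K hKc).integrand = fun _ => 1 := rfl

/-! ### Step 1: the four quarters of the solid -/

/-- The open quarter `{ε₀ x₀ > 0, ε₁ x₁ > 0}` of the solid of revolution (`ε₀, ε₁ = ±1`). -/
def soloInformedRevQuarterSet (ε₀ ε₁ : ℚ) (A : Set (Fin 2 → ℝ)) : Set (Fin 3 → ℝ) :=
  {x | 0 < (ε₀ : ℝ) * x 0 ∧ 0 < (ε₁ : ℝ) * x 1 ∧ x ∈ soloInformedRev A}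

/-- Quarters of the solid are `ℚ`-semialgebraic. -/
theorem isSemialgebraic_soloInformedRevQuarterSet (ε₀ ε₁ : ℚ) {A : Set (Fin 2 → ℝ)}
    (hA : IsSemialgebraic ℚ A) : IsSemialgebraic ℚ (soloInformedRevQuarterSet ε₀ ε₁ A) := by
  have h0 := isSemialgebraic_setOf_eval_pos (k := ℚ) (R := ℝ)
    (MvPolynomial.C ε₀ * MvPolynomial.X 0 : MvPolynomial (Fin 3) ℚ)
  have h1 := isSemialgebraic_setOf_eval_pos (k := ℚ) (R := ℝ)
    (MvPolynomial.C ε₁ * MvPolynomial.X 1 : MvPolynomial (Fin 3) ℚ)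
  have h := h0.inter (h1.inter (isSemialgebraic_soloInformedRev hA))
  simp only [map_mul, MvPolynomial.aeval_C, MvPolynomial.aeval_X, eq_ratCast] at h
  have hset : soloInformedRevQuarterSet ε₀ ε₁ A = {x : Fin 3 → ℝ | 0 < (ε₀ : ℝ) * x 0} ∩
      ({x | 0 < (ε₁ : ℝ) * x 1} ∩ soloInformedRev A) := by
    ext x; simp [soloInformedRevQuarterSet]
  rw [hset]
  exact h

/-- The quarter representations `[quarter, 1]` (restrictions of the solid). -/
def soloInformedRevQuarterRep (ε₀ ε₁ : ℚ) (K : IntegralRep 2) (hKc : IsCompact K.domain) :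
    IntegralRep 3 :=
  (soloInformedRevRep K hKc).restrict (soloInformedRevQuarterSet ε₀ ε₁ K.domain)
    (isSemialgebraic_soloInformedRevQuarterSet ε₀ ε₁ K.isSemialgebraic_domain) fun _ hx => hx.2.2

/-- Domain of a quarter representation. -/
@[simp] theorem soloInformedRevQuarterRep_domain (ε₀ ε₁ : ℚ) (K : IntegralRep 2)
    (hKc : IsCompact K.domain) : (soloInformedRevQuarterRep ε₀ ε₁ K hKc).domain =
      soloInformedRevQuarterSet ε₀ ε₁ K.domain := rfl

/-- Integrand of a quarter representation. -/
@[simp] theorem soloInformedRevQuarterRep_integrand (ε₀ ε₁ : ℚ) (K : IntegralRep 2)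
    (hKc : IsCompact K.domain) :
    (soloInformedRevQuarterRep ε₀ ε₁ K hKc).integrand = fun _ => 1 := rfl

/-- The four quarters, indexed by `Fin 4` through the sign tables of `SoloInformedPiDiscQuarters`. -/
def soloInformedRevQuarter (K : IntegralRep 2) (hKc : IsCompact K.domain) (i : Fin 4) :
    IntegralRep 3 :=
  soloInformedRevQuarterRep (soloInformedSign₀ i) (soloInformedSign₁ i) K hKc

/-- A point of space lies in at most one open quarter. -/
theorem soloInformed_revQuarter_eq_of_mem (K : IntegralRep 2) (hKc : IsCompact K.domain)
    {i j : Fin 4} {x : Fin 3 → ℝ} (hi : x ∈ (soloInformedRevQuarter K hKc i).domain)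
    (hj : x ∈ (soloInformedRevQuarter K hKc j).domain) : i = j := by
  obtain ⟨a, b, -⟩ := hi
  obtain ⟨c, d, -⟩ := hj
  fin_cases i <;> fin_cases j <;> norm_num [soloInformedSign₀, soloInformedSign₁] at a b c d ⊢ <;>
    linarith

/-- **Step 1.** `[Rev K, 1] − ∑ᵢ [quarterᵢ, 1] ∈ relations` (rule (1a); the planes `x₀ = 0`,
`x₁ = 0` are null). -/
theorem soloInformed_revRep_sub_sum_quarter_mem_relations (K : IntegralRep 2)
    (hKc : IsCompact K.domain) :
    of (soloInformedRevRep K hKc) - ∑ i : Fin 4, of (soloInformedRevQuarter K hKc i) ∈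
      relations := by
  refine of_sub_sum_of_mem_relations Finset.univ (soloInformedRevRep K hKc)
    (soloInformedRevQuarter K hKc) (fun i _ => ?_) (fun i _ x _ => rfl) ?_ ?_
  · exact measure_mono_null (fun x hx => (hx.2 hx.1.2.2 : False)) measure_empty
  · have hax : ∀ (i : Fin 3) (c : ℝ), volume {u : Fin 3 → ℝ | u i = c} = 0 := fun i c => by
      rw [volume_pi]; exact Measure.pi_hyperplane _ _ _
    refine measure_mono_null (fun x hx => ?_) (measure_union_null (hax 0 0) (hax 1 0))
    rcases hx with ⟨hxD, hxU⟩
    by_contra hne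
    simp only [mem_union, mem_setOf_eq, not_or] at hne
    apply hxU
    simp only [mem_iUnion, Finset.mem_univ, exists_prop, true_and]
    rcases lt_or_lt_iff_ne.mpr hne.1 with h0 | h0 <;> rcases lt_or_lt_iff_ne.mpr hne.2 with h1 | h1
    · refine ⟨2, ?_⟩
      show x ∈ soloInformedRevQuarterSet (soloInformedSign₀ 2) (soloInformedSign₁ 2) K.domain
      rw [soloInformedSign₀_two, soloInformedSign₁_two]
      refine ⟨?_, ?_, hxD⟩ <;> push_cast <;> linarith
    · refine ⟨1, ?_⟩
      show x ∈ soloInformedRevQuarterSet (soloInformedSign₀ 1) (soloInformedSign₁ 1) K.domain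
      rw [soloInformedSign₀_one, soloInformedSign₁_one]
      refine ⟨?_, ?_, hxD⟩ <;> push_cast <;> linarith
    · refine ⟨3, ?_⟩
      show x ∈ soloInformedRevQuarterSet (soloInformedSign₀ 3) (soloInformedSign₁ 3) K.domain
      rw [soloInformedSign₀_three, soloInformedSign₁_three]
      refine ⟨?_, ?_, hxD⟩ <;> push_cast <;> linarith
    · refine ⟨0, ?_⟩
      show x ∈ soloInformedRevQuarterSet (soloInformedSign₀ 0) (soloInformedSign₁ 0) K.domain
      rw [soloInformedSign₀_zero, soloInformedSign₁_zero]
      refine ⟨?_, ?_, hxD⟩ <;> push_cast <;> linarith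
  · intro i _ j _ hij
    exact measure_mono_null
      (fun x hx => hij (soloInformed_revQuarter_eq_of_mem K hKc hx.1 hx.2)) measure_empty

/-! ### Step 2: sign flips identify the quarters -/

/-- The profile is invariant under the sign flips `(x₀, x₁, x₂) ↦ (ε₀ x₀, ε₁ x₁, x₂)`. -/
theorem soloInformed_profile_flip (ε₀ ε₁ : ℚ) (h₀ : ε₀ ^ 2 = 1) (h₁ : ε₁ ^ 2 = 1)
    (x : Fin 3 → ℝ) : soloInformedProfile (soloInformedFlip ![ε₀, ε₁, 1] x) = soloInformedProfile x := by
  have p₀ : ((ε₀ : ℝ) * x 0) ^ 2 = x 0 ^ 2 := by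
    rw [mul_pow, show ((ε₀ : ℝ)) ^ 2 = 1 by exact_mod_cast h₀, one_mul]
  have p₁ : ((ε₁ : ℝ) * x 1) ^ 2 = x 1 ^ 2 := by
    rw [mul_pow, show ((ε₁ : ℝ)) ^ 2 = 1 by exact_mod_cast h₁, one_mul]
  ext j
  fin_cases j
  · simp [soloInformedProfile, p₀, p₁]
  · simp [soloInformedProfile]

/-- A sign flip identifies the quarter `(ε₀, ε₁)` with the first quarter (rule (2), `|det| = 1`). -/
theorem soloInformed_revQuarterRep_sub_mem_relations (ε₀ ε₁ : ℚ) (h₀ : ε₀ ^ 2 = 1)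
    (h₁ : ε₁ ^ 2 = 1) (K : IntegralRep 2) (hKc : IsCompact K.domain) :
    of (soloInformedRevQuarterRep ε₀ ε₁ K hKc) - of (soloInformedRevQuarterRep 1 1 K hKc) ∈
      relations := by
  have h₀' : (ε₀ : ℝ) ^ 2 = 1 := by exact_mod_cast h₀
  have h₁' : (ε₁ : ℝ) ^ 2 = 1 := by exact_mod_cast h₁
  have e₀ : ∀ t : ℝ, (ε₀ : ℝ) * ((ε₀ : ℝ) * t) = t := fun t => by
    rw [← mul_assoc, ← sq, h₀', one_mul]
  have e₁ : ∀ t : ℝ, (ε₁ : ℝ) * ((ε₁ : ℝ) * t) = t := fun t => by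
    rw [← mul_assoc, ← sq, h₁', one_mul]
  refine soloInformed_of_sub_of_linInvol_mem_relations (soloInformedFlip ![ε₀, ε₁, 1])
    (fun j => MvPolynomial.C (![ε₀, ε₁, 1] j) * MvPolynomial.X j) (fun x j => by simp)
    (fun x => ?_) _ _ (fun y => ?_) (fun x _ => rfl)
  · ext j
    fin_cases j
    · simp [e₀]
    · simp [e₁]
    · simp
  · simp only [soloInformedRevQuarterRep_domain, soloInformedRevQuarterSet, mem_setOf_eq,
      soloInformed_mem_rev, soloInformed_profile_flip ε₀ ε₁ h₀ h₁, soloInformedFlip_apply,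
      Matrix.cons_val_zero, Matrix.cons_val_one, Rat.cast_one, one_mul, e₀, e₁]

/-- **Step 2.** Every quarter of the solid is equivalent to the first one. -/
theorem soloInformed_revQuarter_sub_quarter_zero_mem_relations (K : IntegralRep 2)
    (hKc : IsCompact K.domain) (i : Fin 4) :
    of (soloInformedRevQuarter K hKc i) - of (soloInformedRevQuarter K hKc 0) ∈ relations := by
  have h : soloInformedSign₀ i ^ 2 = 1 ∧ soloInformedSign₁ i ^ 2 = 1 := by
    fin_cases i <;> norm_num [soloInformedSign₀, soloInformedSign₁]
  exact soloInformed_revQuarterRep_sub_mem_relations _ _ h.1 h.2 K hKc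

/-- Steps 1–2 combined: `[Rev K, 1] − 4 · [first quarter, 1] ∈ relations`. -/
theorem soloInformed_revRep_sub_four_nsmul_quarter_mem_relations (K : IntegralRep 2)
    (hKc : IsCompact K.domain) :
    of (soloInformedRevRep K hKc) - 4 • of (soloInformedRevQuarterRep 1 1 K hKc) ∈ relations := by
  have h1 := soloInformed_revRep_sub_sum_quarter_mem_relations K hKc
  rw [Fin.sum_univ_four] at h1
  have h2 := soloInformed_revQuarter_sub_quarter_zero_mem_relations K hKc
  have h0 : soloInformedRevQuarter K hKc 0 = soloInformedRevQuarterRep 1 1 K hKc := by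
    simp [soloInformedRevQuarter]
  rw [← h0]
  have e : of (soloInformedRevRep K hKc) - 4 • of (soloInformedRevQuarter K hKc 0) =
      (of (soloInformedRevRep K hKc) - (of (soloInformedRevQuarter K hKc 0) +
        of (soloInformedRevQuarter K hKc 1) + of (soloInformedRevQuarter K hKc 2) +
        of (soloInformedRevQuarter K hKc 3))) +
      ((of (soloInformedRevQuarter K hKc 1) - of (soloInformedRevQuarter K hKc 0)) +
        (of (soloInformedRevQuarter K hKc 2) - of (soloInformedRevQuarter K hKc 0)) +
        (of (soloInformedRevQuarter K hKc 3) - of (soloInformedRevQuarter K hKc 0))) := by abel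
  rw [e]
  exact relations.add_mem h1 (relations.add_mem (relations.add_mem (h2 1) (h2 2)) (h2 3))

end Summit.KontsevichZagierPeriods.KontsevichZagierPeriods.Theorems
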